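import Summits.BirchSwinnertonDyer.BirchSwinnertonDyer.Theorems.SylvesterTwoHeegnerIndexCoupledUpperBoundReduction
import HarnessLib

/-!
# Route `SylvesterTwoHeegnerIndex` (rung K7t), crux `UpperOffV0HSYPlus` (item 19804):
# K3R-7 — the typed conclusion of THEOREM K3* on `p ≡ 7 (mod 9)` and the splices showing that the two
# typed conclusions give the WHOLE residual (OFFB) and the crux with no PRE input

HONEST FRAMING (cell «bsd-cm», `run/shared/lean/pub/bsd-cm/`; seat `bsd-cm-two` gen 12; planner word D322 (w3)
«K3R-twin, SIBLING file»; `--supports stmt-BirchSwinnertonDyer-19804 --as helper`). NOTHING IS PROVED ABOUT THE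
CRUX HERE. Sequel of `…CoupledUpperBoundReduction.lean` (p563747): that file types the conclusion of the
refereed paper THEOREM K3 on `p ≡ 4 (mod 9)`; memo `MEMO-bsd-cm-two` v2.19 §67 («THEOREM K3*», CANDIDATE,
awaiting its referee desk (M-K3-7)) extends the paper proof to `p ≡ 7 (mod 9)`: the only residue-dependent
input of the `p ≡ 4` proof is the vanishing of `H¹` at the prime `w = (√−3)` of `K = ℚ(ω)` for `B = E_p`,
and for `p ≡ 7` it is replaced by LEMMA W1 (`H¹(Gal(K_w/ℚ₃), B(K_w)) = 0`, so the exact unramified descent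
K0 still holds) and LEMMA W2 (the Artin symbol of `√−3` at `w` fixes every CM point of the conductor-`9pn`
tower by THEOREM C's 3-adic identity (★), so every derived point is twice another — `M_r ≥ 1` — and every
Kolyvagin class is Kummer at `w`). The typed conclusion is the SAME analytic pair inequality with `p % 9 = 7`
(its right side is `2m(p) − 2` there, Hu–Shu–Yin's `i = −2`). This file: the typed `Prop`
`CoupledUpperBoundAtTwoSevenModNine`; the same IFF to the upper half under the facts; the restricted residual
VERBATIM (the shape VARIANT I of the crux calls `stub_upperOffV0B_HSY_sevenModNine`); and the splices: the
two typed conclusions TOGETHER give VARIANT H's `stub_upperOffV0B_HSY` VERBATIM and the crux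
`UpperOffV0HSYPlus` BY NAME with NO Yin display / toric decomposition / (C′) input.

WHAT THIS IS NOT: not a proof of K3*, of any stub, or of any case of the crux; no Euler-system formalisation;
no registration (the planner re-points VARIANT I's (OFFB-7) stub only after desk (M-K3-7) PASSES); BSD is not
claimed for any curve. References: [HuShuYin2019] Thm 1.3/1.4, Cor 4.4, (bsd) p. 12; [McCallumLMS1991] §5;
[GrossLMS1991] §3–§10; cell memo two v2.19 §57, §64–§67.
-/

set_option autoImplicit false
set_option linter.dupNamespace false

noncomputable section

open scoped Classical

open WeierstrassCurve Literature.NumberTheory.EllipticCurves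
  Literature.NumberTheory.EllipticCurves.Rank1Residual.Typed
  Literature.NumberTheory.EllipticCurves.HuShuYin2019
  Summit.BirchSwinnertonDyer.Rank1Residual
  Summit.BirchSwinnertonDyer.BirchSwinnertonDyer.Theses.SylvesterTwoHeegnerIndex
  Summit.BirchSwinnertonDyer.BirchSwinnertonDyer.Theorems

namespace Summit.BirchSwinnertonDyer.BirchSwinnertonDyer.Theorems.SylvesterTwoCoupledUpperBound

/-! ## §1 The `p ≡ 7 (mod 9)` residue class (memo two v2.19 §67: THEOREM K3* — candidate, awaiting its
referee desk) and, §2, the two classes together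

§67 of the memo extends the paper theorem K3 to `p ≡ 7 (mod 9)`: the only residue-dependent input of the
`p ≡ 4 (mod 9)` proof is the vanishing of `H¹` at the prime `w = (√−3)` for `B = E_p`, and for
`p ≡ 7 (mod 9)` it is replaced by LEMMA W1 (`H¹(Gal(K_w/ℚ₃), B(K_w)) = 0`, so the exact unramified descent
K0 still holds) and LEMMA W2 (the Artin symbol of `√−3` at `w` fixes every CM point of the conductor-`9pn`
tower by THEOREM C's identity (★), so every derived point is twice another — `M_r ≥ 1` — and every
Kolyvagin class is Kummer at `w`). The typed conclusion is the SAME analytic pair inequality with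
`p % 9 = 7`; by Hu–Shu–Yin's display its right side is `2m − 2` there. Below: the typed `Prop`, the same
IFF to the upper half, and the splices showing that the two typed conclusions TOGETHER give VARIANT H's
`stub_upperOffV0B_HSY` VERBATIM and the crux `UpperOffV0HSYPlus` with NO Yin/PRE input. Nothing asserted. -/

/-- **K3\*'s conclusion on `p ≡ 7 (mod 9)`, typed** (same analytic pair form as
`CoupledUpperBoundAtTwoFourModNine`): for every prime `p ≡ 7 (mod 9)` with `3 ∉ 𝔽_p^{×3}` and all
globally minimal `B ≅ E_p`, `A ≅ E_{3p²}`: `#Ш_an(B) = qB`, `#Ш_an(A) = qA`, `qB·qA ≠ 0` and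
`ord₂ #Ш(B)[2^∞] + ord₂ #Ш(A)[2^∞] ≤ ord₂(qB·qA)` (`= 2m(p) − 2` by the display, HSY's `i = −2`). This is
the conclusion of memo §67's THEOREM K3* on this residue class (candidate CELL theorem on paper: coupled
McCallum structure theorem at `2` + `M_r ≥ 1` from THEOREM C's 3-adic symmetry); OPEN in the kernel;
nothing asserted. [cite: HuShuYin2019, Cor. 4.4 and (bsd) p. 12] [cite: McCallumLMS1991, Thm. 5.4]
[cite: Kolyvagin1990, Thm. A] -/
@[conjecture] def CoupledUpperBoundAtTwoSevenModNine : Prop :=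
  ∀ (p : ℕ), p.Prime → p % 9 = 7 → (¬ ∃ x : ZMod p, x ^ 3 = 3) →
    ∀ (A B : WeierstrassCurve ℚ) [A.IsElliptic] [A.IsGloballyMinimal] [B.IsElliptic]
      [B.IsGloballyMinimal],
      (∃ C : VariableChange ℚ, C • B = cubeSumCurve (p : ℚ)) →
      (∃ C : VariableChange ℚ, C • A = cubeSumCurve (3 * (p : ℚ) ^ 2)) →
      ∃ qB qA : ℚ, shaAn B = (qB : ℂ) ∧ shaAn A = (qA : ℂ) ∧ qB * qA ≠ 0 ∧
        (padicValNat 2 (Nat.card (AddCommGroup.primaryComponent B.sha 2)) : ℤ) +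
            (padicValNat 2 (Nat.card (AddCommGroup.primaryComponent A.sha 2)) : ℤ) ≤
          padicValRat 2 (qB * qA)

/-- **The right side is even on `p ≡ 7 (mod 9)` too**, granted the display AND the cell's THEOREM C
(bsd-cm-two's fact-free `SylvesterTwoNonneg.HSYPointTwoDivisibleSevenModNine`, the open sibling item 19802
of this crux): `ord₂(#Ш_an(B)·#Ш_an(A)) = 2n`, `n : ℕ` — x1b/two's assembly
`SylvesterTwoThmCAssembly.twoAdicPairHSY_of_heightDisplay_of_thmC`, re-exported under this file's binders.
[cite: HuShuYin2019, display (bsd) p. 12, p. 8] -/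
theorem even_rhs_of_facts_sevenModNine (hF : PublishedFactsTwoPlus)
    (hC : SylvesterTwoNonneg.HSYPointTwoDivisibleSevenModNine) {p : ℕ} (hp : p.Prime)
    (h7 : p % 9 = 7) (h3 : ¬ ∃ x : ZMod p, x ^ 3 = 3) (A B : WeierstrassCurve ℚ) [A.IsElliptic]
    [A.IsGloballyMinimal] [B.IsElliptic] [B.IsGloballyMinimal]
    (hB : ∃ C : VariableChange ℚ, C • B = cubeSumCurve (p : ℚ))
    (hA : ∃ C : VariableChange ℚ, C • A = cubeSumCurve (3 * (p : ℚ) ^ 2)) :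
    ∃ qB qA : ℚ, shaAn B = (qB : ℂ) ∧ shaAn A = (qA : ℂ) ∧ qB * qA ≠ 0 ∧
      ∃ n : ℕ, padicValRat 2 (qB * qA) = 2 * n :=
  SylvesterTwoThmCAssembly.twoAdicPairHSY_of_heightDisplay_of_thmC hF.2 hC p hp (Or.inr h7) h3 A B hB hA

/-- **The `p ≡ 7 (mod 9)` last inch is the same IFF.** Granted `PublishedFactsTwoPlus`:
`CoupledUpperBoundAtTwoSevenModNine` holds iff every globally minimal `B ≅ E_p`, `p ≡ 7 (mod 9)` prime,
`3 ∉ 𝔽_p^{×3}`, satisfies `MissingUpperBoundAt B 2` (k7t-c2's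
`SylvesterTwoUpper.missingUpperBoundAt_iff_pairBound` is stated for both residue classes).
[cite: HuShuYin2019, Cor. 4.4 and (bsd) p. 12] [cite: BurungaleFlach2024, Thm. 1.1 and Cor. 2]
[cite: Miller2011LMS, Def. 1.1] [cite: SilvermanAEC2009, VIII.8 Cor. 8.3] -/
theorem coupledUpperBoundSeven_iff_missingUpperBoundAt (hF : PublishedFactsTwoPlus) :
    CoupledUpperBoundAtTwoSevenModNine ↔
      ∀ (p : ℕ), p.Prime → p % 9 = 7 → (¬ ∃ x : ZMod p, x ^ 3 = 3) →
        ∀ (B : WeierstrassCurve ℚ) [B.IsElliptic] [B.IsGloballyMinimal],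
          (∃ C : VariableChange ℚ, C • B = cubeSumCurve (p : ℚ)) → MissingUpperBoundAt B 2 := by
  obtain ⟨⟨hHSY, hCM0, hmod, -⟩, -⟩ := hF
  refine ⟨fun h p hp h7 h3 B _ _ hB => ?_, fun h p hp h7 h3 A B _ _ _ _ hB hA => ?_⟩
  · have hn : (3 * (p : ℚ) ^ 2) ≠ 0 :=
      mul_ne_zero (by norm_num) (pow_ne_zero _ (Nat.cast_ne_zero.mpr hp.ne_zero))
    haveI := X12.CubeSumFamilies.isElliptic_cubeSumCurve hn
    obtain ⟨A, _, _, CA, hCA⟩ :=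
      X12.CubeSumFamilies.exists_isGloballyMinimal_model (cubeSumCurve (3 * (p : ℚ) ^ 2))
    exact (SylvesterTwoUpper.missingUpperBoundAt_iff_pairBound hHSY hCM0 hmod hp (Or.inr h7) h3 A B hB
      ⟨CA, hCA⟩).mpr (h p hp h7 h3 A B hB ⟨CA, hCA⟩)
  · exact (SylvesterTwoUpper.missingUpperBoundAt_iff_pairBound hHSY hCM0 hmod hp (Or.inr h7) h3 A B hB
      hA).mp (h p hp h7 h3 B hB)

/-- **K3\* ⇒ the upper half for every `p ≡ 7 (mod 9)` member**, granted the facts.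
[cite: HuShuYin2019, Cor. 4.4 and (bsd) p. 12] [cite: Miller2011LMS, Def. 1.1] -/
theorem missingUpperBoundAt_two_of_coupledUpperBoundSeven (hF : PublishedFactsTwoPlus)
    (hK7 : CoupledUpperBoundAtTwoSevenModNine) {p : ℕ} (hp : p.Prime) (h7 : p % 9 = 7)
    (h3 : ¬ ∃ x : ZMod p, x ^ 3 = 3) (B : WeierstrassCurve ℚ) [B.IsElliptic] [B.IsGloballyMinimal]
    (hB : ∃ C : VariableChange ℚ, C • B = cubeSumCurve (p : ℚ)) : MissingUpperBoundAt B 2 :=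
  (coupledUpperBoundSeven_iff_missingUpperBoundAt hF).mp hK7 p hp h7 h3 B hB

/-- **K3\* ⇒ VARIANT H/I's residual restricted to `p % 9 = 7`, VERBATIM** (the shape the planner's
VARIANT I calls `stub_upperOffV0B_HSY_sevenModNine`; the carried hypothesis `#Ш(B)[2^∞] ≠ 1` is not used).
[cite: HuShuYin2019, Cor. 4.4 and (bsd) p. 12] [cite: McCallumLMS1991, Thm. 5.4] -/
theorem upperOffV0B_sevenModNine_of_coupledUpperBound (hK7 : CoupledUpperBoundAtTwoSevenModNine) :
    PublishedFactsTwoPlus →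
      ∀ (p : ℕ), p.Prime → p % 9 = 7 → (¬ ∃ x : ZMod p, x ^ 3 = 3) →
        ∀ (B : WeierstrassCurve ℚ) [B.IsElliptic] [B.IsGloballyMinimal],
          (∃ C : VariableChange ℚ, C • B = cubeSumCurve (p : ℚ)) →
          Nat.card (AddCommGroup.primaryComponent B.sha 2) ≠ 1 → MissingUpperBoundAt B 2 :=
  fun hF _ hp h7 h3 B _ _ hB _ => missingUpperBoundAt_two_of_coupledUpperBoundSeven hF hK7 hp h7 h3 B hB

/-- **The two typed conclusions together give VARIANT H's `stub_upperOffV0B_HSY` VERBATIM** (K3 on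
`p ≡ 4` — refereed — and K3\* on `p ≡ 7` — candidate — spliced by `upperOffV0B_of_residues`).
[cite: HuShuYin2019, Cor. 4.4 and (bsd) p. 12] [cite: McCallumLMS1991, Thm. 5.4] -/
theorem upperOffV0B_of_coupledUpperBounds (hK4 : CoupledUpperBoundAtTwoFourModNine)
    (hK7 : CoupledUpperBoundAtTwoSevenModNine) :
    PublishedFactsTwoPlus →
      ∀ (p : ℕ), p.Prime → (p % 9 = 4 ∨ p % 9 = 7) → (¬ ∃ x : ZMod p, x ^ 3 = 3) →
        ∀ (B : WeierstrassCurve ℚ) [B.IsElliptic] [B.IsGloballyMinimal],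
          (∃ C : VariableChange ℚ, C • B = cubeSumCurve (p : ℚ)) →
          Nat.card (AddCommGroup.primaryComponent B.sha 2) ≠ 1 → MissingUpperBoundAt B 2 :=
  upperOffV0B_of_residues (upperOffV0B_fourModNine_of_coupledUpperBound hK4)
    (upperOffV0B_sevenModNine_of_coupledUpperBound hK7)

/-- **Both typed conclusions ⇒ the upper half `MissingUpperBoundAt B 2` for EVERY member of 𝒞_HSY with
`3 ∉ 𝔽_p^{×3}`** (on and off `𝒱₀`), granted the facts — the content of ROAD (k) in Miller's currency.
[cite: HuShuYin2019, Cor. 4.4 and (bsd) p. 12] [cite: Miller2011LMS, Def. 1.1] -/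
theorem missingUpperBoundAt_two_of_coupledUpperBounds (hF : PublishedFactsTwoPlus)
    (hK4 : CoupledUpperBoundAtTwoFourModNine) (hK7 : CoupledUpperBoundAtTwoSevenModNine)
    {p : ℕ} (hp : p.Prime) (h9 : p % 9 = 4 ∨ p % 9 = 7) (h3 : ¬ ∃ x : ZMod p, x ^ 3 = 3)
    (B : WeierstrassCurve ℚ) [B.IsElliptic] [B.IsGloballyMinimal]
    (hB : ∃ C : VariableChange ℚ, C • B = cubeSumCurve (p : ℚ)) : MissingUpperBoundAt B 2 := by
  rcases h9 with h4 | h7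
  · exact missingUpperBoundAt_two_of_coupledUpperBound hF hK4 hp h4 h3 B hB
  · exact missingUpperBoundAt_two_of_coupledUpperBoundSeven hF hK7 hp h7 h3 B hB

/-- **The crux `UpperOffV0HSYPlus` BY NAME from the two typed conclusions ALONE — no Yin display (Y), no
toric decomposition (T), no (C′):** the research residual of item 19804 is, on paper, K3 + K3\*; in the
kernel it is exactly these two displayed `Prop`s. Nothing is claimed about either.
[cite: HuShuYin2019, Cor. 4.4 and (bsd) p. 12] [cite: McCallumLMS1991, Thm. 5.4] -/
theorem upperOffV0HSYPlus_of_coupledUpperBounds (hK4 : CoupledUpperBoundAtTwoFourModNine)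
    (hK7 : CoupledUpperBoundAtTwoSevenModNine) : UpperOffV0HSYPlus :=
  fun hF _ hp h9 h3 _ B _ _ _ _ hB _ _ => missingUpperBoundAt_two_of_coupledUpperBounds hF hK4 hK7 hp h9 h3 B hB

end Summit.BirchSwinnertonDyer.BirchSwinnertonDyer.Theorems.SylvesterTwoCoupledUpperBound

end
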